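import Summits.Ventures.HSemireg.EmbeddedFirstOrderDeformationsCocycle
import Literature.AlgebraicGeometry.Resolution.LocalizedSurjection
import Mathlib.RingTheory.Localization.Algebra
import Mathlib.RingTheory.Localization.Module
import HarnessLib

/-!
# Venture HSemireg — base change of embedded first-order deformations along a ring map `f : R → S`, and
# «the construction is compatible with localization» (Hartshorne, *Deformation Theory*, Thm. 2.4)

HONEST FRAMING.  Lean side of the computation cell `pub-hsemireg` (track «S4-PUSH» (ii), seat s4-prove-3 g3, second
route for (S5)); log `s4push/prove-3/ATTEMPT-6.md`.  Plain commutative algebra for EVERY ring map `f : R →+* S` of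
commutative rings and EVERY ideal `I ⊆ R`; no scheme, sheaf, Čech complex, abelian variety or semiregularity map is
constructed; nothing here says that HC, HC_CM or HC_AV holds; no object is certified; no Literature fact is declared.

WHY.  The local dictionary of this seat's files (`EmbeddedFirstOrderDeformations`: Hartshorne Prop. 2.3, flat embedded
first-order deformations of `V(I) ⊂ Spec R[ε]` `≃ Hom_R(I, R/I)` via `liftIdeal` / `normalVector`; `…Cocycle`:
`twist D (liftIdeal I φ) = liftIdeal I (φ + D̄|_I)`, the local step of PROPOSITION K of the cell's G2-REDUCIBLE-POINT-THEOREM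
§3) is stated chart by chart.  The Čech sentence of Prop. K («`(π(θ_αβ))` is a coboundary ⟺ a global flat lift exists»)
RESTRICTS lifts `J_φ` and transition twists from charts to overlaps, i.e. base-changes them along localisations; Hartshorne's
Thm. 2.4 passes from Prop. 2.3 to `H⁰(Y, N_{Y/X})` by the remark «the construction is compatible with localization».  THIS
FILE makes that remark a theorem.  Namespace `Summit.Ventures.HSemireg.EmbeddedDeformation`:
* §1 `mapRingHom f : R[ε] →+* S[ε]`, `a + εb ↦ f a + ε f b` (Mathlib's `TrivSqZeroExt.map` changes the module, not the ring);
* §2 `Compatible f φ ψ` («`ψ ∈ Hom_S(IS, S/IS)` is the base change of `φ ∈ Hom_R(I, R/I)`»: `ψ(f x) = f̄(φ x)`), `zero/add`,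
  and UNIQUENESS for every `f` (`Compatible.unique`: `IS` is `S`-spanned by `f(I)`);
* §3 **`map_mapRingHom_liftIdeal`: `(liftIdeal I φ)·S[ε] = liftIdeal (IS) ψ`** for every compatible pair; hence the base
  change of a flat embedded first-order deformation with normal vector `φ` is one with normal vector `ψ`
  (`isEmbeddedDeformation_map_mapRingHom`, `normalVector_map_mapRingHom`; trivial lift ↦ trivial lift).  Sharp: with no
  compatible `ψ` flatness can die (`k[x] → k`, `(x + ε) ↦ (ε)`);
* §4 for `f`-related derivations (`f ∘ D_R = D_S ∘ f`): `f[ε] ∘ twist D_R = twist D_S ∘ f[ε]`, `Compatible f (D̄_R|_I) (D̄_S|_{IS})`,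
  hence **base change of the twisted lift = twist of the base-changed lift** — Prop. K's local step restricted to an overlap;
* §5 `S = T⁻¹R` (Thm. 2.4): the compatible `ψ` EXISTS — `locNormal T S I φ`, from Mathlib's `Algebra.idealMap_isLocalizedModule`
  (`I → I·S`) and the tree's `Literature.AlgebraicGeometry.Resolution.isLocalizedModule_quotientMapₗ` (`R/I → S/IS`) —
  `existsUnique_compatible`, **`map_liftIdeal_eq_liftIdeal_locNormal`** (`J_φ` restricted to `Spec T⁻¹R` is `J_{φ_T}`),
  `isEmbeddedDeformation_map_of_isLocalization`, `normalVector_map_of_isLocalization`, `locNormal_derivToNormal`.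

NOT covered (stays binder in the (S5) files): GLUING compatible local lifts along a Zariski cover into a global lift (descent
for ideals + locality of flatness — the converse half of the Čech sentence); `(θ_αβ) ↔ ξ ∈ H¹(A, T_A)`; branch-following.

References: R. Hartshorne, *Deformation Theory*, GTM 257 (2010), Ch. 1 §2, Prop. 2.3 and Thm. 2.4 («the construction is
compatible with localization») [corpus: book:springernd-deformation-theory p0015–p0016]; E. Sernesi, *Deformations of
Algebraic Schemes*, Prop. 3.2.1 / §3.2.2.
-/

open DualNumber TrivSqZeroExt

namespace Summit.Ventures.HSemireg

namespace EmbeddedDeformation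

universe u v

section General

variable {R : Type u} [CommRing R] {S : Type v} [CommRing S]

/-! ### §1 The ring-change map `R[ε] → S[ε]` -/

/-- **`f[ε] : R[ε] →+* S[ε]`, `a + εb ↦ f a + ε·f b`** — the base change of the trivial first-order thickening
along a ring map (for `f` a localisation: the restriction of `Spec R[ε]` to the open `Spec T⁻¹R`). [folklore] -/
def mapRingHom (f : R →+* S) : R[ε] →+* S[ε] where
  toFun z := inl (f z.fst) + inr (f z.snd)
  map_one' := by ext <;> simp
  map_mul' z z' := by
    ext
    · simp [fst_add, fst_mul]
    · simp only [snd_add, snd_inl, snd_inr, zero_add, DualNumber.snd_mul, fst_add, fst_inl, fst_inr, add_zero,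
        map_add, map_mul]
  map_zero' := by ext <;> simp
  map_add' z z' := by ext <;> simp [fst_add, snd_add]

/-- `(f[ε] z).fst = f z.fst`. [folklore] -/
@[simp] theorem fst_mapRingHom (f : R →+* S) (z : R[ε]) : (mapRingHom f z).fst = f z.fst := by
  simp [mapRingHom, fst_add]

/-- `(f[ε] z).snd = f z.snd`. [folklore] -/
@[simp] theorem snd_mapRingHom (f : R →+* S) (z : R[ε]) : (mapRingHom f z).snd = f z.snd := by
  simp [mapRingHom, snd_add]

/-- `f[ε] (a) = f a`. [folklore] -/
@[simp] theorem mapRingHom_inl (f : R →+* S) (a : R) : mapRingHom f (inl a) = inl (f a) := by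
  ext <;> simp

/-- `f[ε] ε = ε`. [folklore] -/
@[simp] theorem mapRingHom_eps (f : R →+* S) : mapRingHom f (ε : R[ε]) = ε := by
  ext <;> simp

/-- `f[ε] (x + εy) = f x + ε f y`. [folklore] -/
theorem mapRingHom_inl_add_eps_mul_inl (f : R →+* S) (x y : R) :
    mapRingHom f (inl x + (ε : R[ε]) * inl y) = inl (f x) + (ε : S[ε]) * inl (f y) := by
  ext <;> simp [fst_add, snd_add, fst_mul]

/-! ### §2 Compatible normal vectors along `f` -/

/-- **`ψ` is the base change of `φ` along `f`**: for `φ ∈ Hom_R(I, R/I)` and `ψ ∈ Hom_S(IS, S/IS)`,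
`ψ(f x) = f y mod IS` whenever `φ(x) = y mod I` — i.e. `ψ ∘ f|_I = f̄ ∘ φ`. [folklore] -/
def Compatible (f : R →+* S) {I : Ideal R} (φ : I →ₗ[R] R ⧸ I) (ψ : I.map f →ₗ[S] S ⧸ I.map f) : Prop :=
  ∀ (x : I) (y : R), Ideal.Quotient.mk I y = φ x →
    ψ ⟨f x, Ideal.mem_map_of_mem f x.2⟩ = Ideal.Quotient.mk (I.map f) (f y)

variable {f : R →+* S} {I : Ideal R}

namespace Compatible

/-- `0` is compatible with `0` (`y ∈ I ⟹ f y ∈ IS`). [folklore] -/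
protected theorem zero : Compatible f (0 : I →ₗ[R] R ⧸ I) 0 := by
  intro x y hy
  rw [LinearMap.zero_apply, Ideal.Quotient.eq_zero_iff_mem] at hy
  rw [LinearMap.zero_apply, eq_comm, Ideal.Quotient.eq_zero_iff_mem]
  exact Ideal.mem_map_of_mem f hy

/-- Compatibility is additive. [folklore] -/
protected theorem add {φ φ' : I →ₗ[R] R ⧸ I} {ψ ψ' : I.map f →ₗ[S] S ⧸ I.map f} (h : Compatible f φ ψ)
    (h' : Compatible f φ' ψ') : Compatible f (φ + φ') (ψ + ψ') := by
  intro x y hy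
  obtain ⟨y₁, hy₁⟩ := Ideal.Quotient.mk_surjective (φ x)
  obtain ⟨y₂, hy₂⟩ := Ideal.Quotient.mk_surjective (φ' x)
  have hyy : y - (y₁ + y₂) ∈ I := by
    rw [← Ideal.Quotient.eq, hy, map_add, hy₁, hy₂, LinearMap.add_apply]
  rw [LinearMap.add_apply, h x y₁ hy₁, h' x y₂ hy₂, ← map_add, ← map_add, eq_comm, Ideal.Quotient.eq, ← map_sub]
  exact Ideal.mem_map_of_mem f hyy

/-- **Uniqueness of the base change, for EVERY `f`**: two `S`-linear maps on `IS` compatible with the same `φ`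
are equal, because `IS` is `S`-spanned by `f(I)`. [folklore] -/
protected theorem unique {φ : I →ₗ[R] R ⧸ I} {ψ ψ' : I.map f →ₗ[S] S ⧸ I.map f} (h : Compatible f φ ψ)
    (h' : Compatible f φ ψ') : ψ = ψ' := by
  refine LinearMap.ext fun z ↦ ?_
  obtain ⟨z, hz⟩ := z
  induction hz using Submodule.span_induction with
  | mem s hs =>
    obtain ⟨x, hx, rfl⟩ := hs
    obtain ⟨y, hy⟩ := Ideal.Quotient.mk_surjective (φ ⟨x, hx⟩)
    rw [h ⟨x, hx⟩ y hy, h' ⟨x, hx⟩ y hy]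
  | zero =>
    rw [show (⟨0, Submodule.zero_mem _⟩ : I.map f) = 0 from rfl, map_zero, map_zero]
  | add a b ha hb iha ihb =>
    rw [show (⟨a + b, Submodule.add_mem _ ha hb⟩ : I.map f) = ⟨a, ha⟩ + ⟨b, hb⟩ from rfl, map_add, map_add,
      iha, ihb]
  | smul c a ha iha =>
    rw [show (⟨c • a, Submodule.smul_mem _ c ha⟩ : I.map f) = c • ⟨a, ha⟩ from rfl, map_smul, map_smul, iha]

end Compatible

/-! ### §3 Base change of Hartshorne's ideal `I'` -/

/-- `ε·u ∈ (I')·S[ε]` for `u ∈ IS` (the `εI`-part base-changes on the nose). [folklore] -/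
theorem eps_mul_inl_mem_map_mapRingHom (φ : I →ₗ[R] R ⧸ I) {u : S} (hu : u ∈ I.map f) :
    (ε : S[ε]) * inl u ∈ (liftIdeal I φ).map (mapRingHom f) := by
  induction hu using Submodule.span_induction with
  | mem s hs =>
    obtain ⟨a, ha, rfl⟩ := hs
    have hmem : (ε : R[ε]) * inl a ∈ liftIdeal I φ := by
      rw [show (ε : R[ε]) * inl a = inl 0 + (ε : R[ε]) * inl a by rw [inl_zero, zero_add],
        inl_add_eps_mul_inl_mem_liftIdeal_iff]
      refine ⟨I.zero_mem, ?_⟩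
      rw [show (⟨0, I.zero_mem⟩ : I) = 0 from rfl, map_zero, Ideal.Quotient.eq_zero_iff_mem]
      exact ha
    have := Ideal.mem_map_of_mem (mapRingHom f) hmem
    simpa [map_mul] using this
  | zero => simp
  | add a b _ _ iha ihb =>
    rw [inl_add, mul_add]
    exact Ideal.add_mem _ iha ihb
  | smul c a _ iha =>
    rw [smul_eq_mul, inl_mul, mul_left_comm]
    exact Ideal.mul_mem_left _ _ iha

/-- Every `s ∈ IS` has a lift `s + εt ∈ (I')·S[ε]` with `t̄ = ψ(s)`, for `ψ` compatible with `φ`. [folklore] -/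
theorem exists_inl_add_eps_mul_inl_mem_map {φ : I →ₗ[R] R ⧸ I} {ψ : I.map f →ₗ[S] S ⧸ I.map f}
    (hc : Compatible f φ ψ) {s : S} (hs : s ∈ I.map f) :
    ∃ t : S, inl s + (ε : S[ε]) * inl t ∈ (liftIdeal I φ).map (mapRingHom f) ∧
      Ideal.Quotient.mk (I.map f) t = ψ ⟨s, hs⟩ := by
  induction hs using Submodule.span_induction with
  | mem s hs =>
    obtain ⟨a, ha, rfl⟩ := hs
    obtain ⟨y, hy⟩ := Ideal.Quotient.mk_surjective (φ ⟨a, ha⟩)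
    refine ⟨f y, ?_, (hc ⟨a, ha⟩ y hy).symm⟩
    rw [← mapRingHom_inl_add_eps_mul_inl]
    exact Ideal.mem_map_of_mem _ (inl_add_eps_mul_inl_mem_liftIdeal_iff.2 ⟨ha, hy⟩)
  | zero => exact ⟨0, by simp, by rw [map_zero, show (⟨0, Submodule.zero_mem _⟩ : I.map f) = 0 from rfl, map_zero]⟩
  | add a b ha hb iha ihb =>
    obtain ⟨t, ht, hta⟩ := iha
    obtain ⟨t', ht', htb⟩ := ihb
    refine ⟨t + t', ?_, ?_⟩
    · have e : inl (a + b) + (ε : S[ε]) * inl (t + t') = (inl a + ε * inl t) + (inl b + ε * inl t') := by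
        rw [inl_add, inl_add, mul_add]; abel
      rw [e]
      exact Ideal.add_mem _ ht ht'
    · rw [map_add, hta, htb, ← map_add]
      rfl
  | smul c a ha iha =>
    obtain ⟨t, ht, hta⟩ := iha
    refine ⟨c * t, ?_, ?_⟩
    · have e : inl (c • a) + (ε : S[ε]) * inl (c * t) = inl c * (inl a + ε * inl t) := by
        rw [smul_eq_mul, inl_mul, inl_mul, mul_add, mul_left_comm]
      rw [e]
      exact Ideal.mul_mem_left _ _ ht
    · calc Ideal.Quotient.mk (I.map f) (c * t)
          = c • Ideal.Quotient.mk (I.map f) t := by rw [map_mul, Algebra.smul_def, Ideal.Quotient.algebraMap_eq]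
        _ = c • ψ ⟨a, ha⟩ := by rw [hta]
        _ = ψ (c • ⟨a, ha⟩) := (map_smul ψ c _).symm
        _ = ψ ⟨c • a, Submodule.smul_mem _ c ha⟩ := rfl

/-- **Base change of Hartshorne's `I'` (every ring map `f`): `(liftIdeal I φ)·S[ε] = liftIdeal (IS) ψ`** for `ψ` the
(unique) `S`-linear map on `IS` compatible with `φ`.  (`⊆`: generators `x + εy`, `ȳ = φ(x)`, go to `f x + ε f y` with
`(f y)‾ = ψ(f x)`; `⊇`: `s + εt'` with `t̄' = ψ(s)` is `(s + εt) + ε(t' - t)` with `s + εt` in the extension by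
`exists_inl_add_eps_mul_inl_mem_map` and `t' - t ∈ IS`.) [cite: Hartshorne2010, §2 Thm. 2.4 («compatible with localization»)] -/
theorem map_mapRingHom_liftIdeal {φ : I →ₗ[R] R ⧸ I} {ψ : I.map f →ₗ[S] S ⧸ I.map f} (hc : Compatible f φ ψ) :
    (liftIdeal I φ).map (mapRingHom f) = liftIdeal (I.map f) ψ := by
  apply le_antisymm
  · rw [Ideal.map_le_iff_le_comap]
    rintro z ⟨x, hx, hz⟩
    rw [Ideal.mem_comap, mem_liftIdeal_iff]
    refine ⟨⟨f x, Ideal.mem_map_of_mem f x.2⟩, by simp [hx], ?_⟩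
    rw [snd_mapRingHom]
    exact (hc x z.snd hz).symm
  · rintro w ⟨s, hs, hw⟩
    obtain ⟨t, ht, hts⟩ := exists_inl_add_eps_mul_inl_mem_map hc s.2
    have hdiff : w.snd - t ∈ I.map f := by
      rw [← Ideal.Quotient.eq, hw, ← hts]
    have e : w = (inl (s : S) + (ε : S[ε]) * inl t) + ε * inl (w.snd - t) := by
      ext <;> simp [fst_add, snd_add, fst_mul, hs]
    rw [e]
    exact Ideal.add_mem _ ht (eps_mul_inl_mem_map_mapRingHom φ hdiff)

/-- **The trivial lift base-changes to the trivial lift**: `(I·R[ε])·S[ε] = (IS)·S[ε]`. [folklore] -/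
theorem map_mapRingHom_liftIdeal_zero (f : R →+* S) (I : Ideal R) :
    (liftIdeal I 0).map (mapRingHom f) = liftIdeal (I.map f) 0 :=
  map_mapRingHom_liftIdeal Compatible.zero

/-- The same in the form `(I·R[ε])·S[ε] = (I·S)·S[ε]`. [folklore] -/
theorem map_mapRingHom_map_algebraMap (f : R →+* S) (I : Ideal R) :
    (I.map (algebraMap R R[ε])).map (mapRingHom f) = (I.map f).map (algebraMap S S[ε]) := by
  rw [← liftIdeal_zero, ← liftIdeal_zero, map_mapRingHom_liftIdeal_zero]

/-- **Base change of a flat embedded first-order deformation** whose normal vector admits a compatible `ψ` on `IS`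
is a flat embedded first-order deformation of `V(IS) ⊂ Spec S`.  (Without such a `ψ` this can fail: `k[x] → k`,
`J = (x + ε)` ↦ `(ε)`, and `k[ε]/(ε)` is not flat over `k[ε]`.) [folklore] -/
theorem isEmbeddedDeformation_map_mapRingHom {J : Ideal R[ε]} (hJ : IsEmbeddedDeformation I J)
    {ψ : I.map f →ₗ[S] S ⧸ I.map f} (hc : Compatible f hJ.normalVector ψ) :
    IsEmbeddedDeformation (I.map f) (J.map (mapRingHom f)) := by
  rw [← liftIdeal_normalVector hJ, map_mapRingHom_liftIdeal hc]
  exact isEmbeddedDeformation_liftIdeal _ _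

/-- **… and its normal vector is `ψ`** (Hartshorne's `φ ↦ I'` commutes with base change). [folklore] -/
theorem normalVector_map_mapRingHom {J : Ideal R[ε]} (hJ : IsEmbeddedDeformation I J)
    {ψ : I.map f →ₗ[S] S ⧸ I.map f} (hc : Compatible f hJ.normalVector ψ) :
    (isEmbeddedDeformation_map_mapRingHom hJ hc).normalVector = ψ := by
  have key : ∀ {J' : Ideal S[ε]} (h' : IsEmbeddedDeformation (I.map f) J'),
      J' = liftIdeal (I.map f) ψ → h'.normalVector = ψ := by
    rintro J' h' rfl
    exact normalVector_liftIdeal _ _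
  refine key _ ?_
  conv_lhs => rw [← liftIdeal_normalVector hJ]
  exact map_mapRingHom_liftIdeal hc

/-! ### §4 Twists and derivations commute with base change -/

section Twist

variable {A : Type*} [CommRing A] [Algebra A R] {B : Type*} [CommRing B] [Algebra B S]

/-- **Base change intertwines the twists**: for derivations `D_R` of `R` and `D_S` of `S` with `f (D_R a) = D_S (f a)`
(e.g. `D_S` the extension of `D_R` to a localisation), `f[ε] ∘ twist D_R = twist D_S ∘ f[ε]`. [folklore] -/
theorem mapRingHom_comp_twist (D : Derivation A R R) (D' : Derivation B S S) (hD : ∀ a, f (D a) = D' (f a)) :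
    (mapRingHom f).comp (twist D : R[ε] →+* R[ε]) = (twist D' : S[ε] →+* S[ε]).comp (mapRingHom f) := by
  refine RingHom.ext fun z ↦ ?_
  ext
  · simp
  · simp [hD]

/-- **`D̄_S|_{IS}` is the base change of `D̄_R|_I`** for compatible derivations. [folklore] -/
theorem compatible_derivToNormal (D : Derivation A R R) (D' : Derivation B S S) (hD : ∀ a, f (D a) = D' (f a)) :
    Compatible f (derivToNormal I D) (derivToNormal (I.map f) D') := by
  intro x y hy
  rw [derivToNormal_apply, Ideal.Quotient.eq] at hy
  rw [derivToNormal_apply, Ideal.Quotient.eq]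
  change D' (f x) - f y ∈ I.map f
  rw [← hD, ← map_sub, show D x - y = -(y - D x) by ring, map_neg]
  exact (Ideal.neg_mem_iff _).2 (Ideal.mem_map_of_mem f hy)

/-- **Base change of the twisted lift = twist of the base-changed lift** (Prop. K's local step
`twist D (J_φ) = J_{φ + D̄|_I}` restricted to an overlap): `((liftIdeal I φ)·twist D_R)·S[ε] = liftIdeal (IS) (ψ + D̄_S|_{IS})`. [folklore] -/
theorem map_mapRingHom_map_twist_liftIdeal (D : Derivation A R R) (D' : Derivation B S S)
    (hD : ∀ a, f (D a) = D' (f a)) {φ : I →ₗ[R] R ⧸ I} {ψ : I.map f →ₗ[S] S ⧸ I.map f}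
    (hc : Compatible f φ ψ) :
    ((liftIdeal I φ).map (twist D : R[ε] →+* R[ε])).map (mapRingHom f) =
      liftIdeal (I.map f) (ψ + derivToNormal (I.map f) D') := by
  rw [map_twist_liftIdeal, map_mapRingHom_liftIdeal (hc.add (compatible_derivToNormal D D' hD))]

/-- The same as a commutation of the two operations on ideals: `(J·twist D_R)·f[ε] = (J·f[ε])·twist D_S`. [folklore] -/
theorem map_mapRingHom_map_twist (D : Derivation A R R) (D' : Derivation B S S) (hD : ∀ a, f (D a) = D' (f a))
    (J : Ideal R[ε]) :
    (J.map (twist D : R[ε] →+* R[ε])).map (mapRingHom f) =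
      (J.map (mapRingHom f)).map (twist D' : S[ε] →+* S[ε]) := by
  rw [Ideal.map_map, Ideal.map_map, mapRingHom_comp_twist D D' hD]

end Twist

end General

/-! ### §5 Localisation: the base change exists (and is unique) — «compatible with localization» -/

section Localization

open Literature.AlgebraicGeometry.Resolution

variable {R : Type u} [CommRing R] (T : Submonoid R) (S : Type u) [CommRing S] [Algebra R S] [IsLocalization T S]
variable (I : Ideal R)

/-- **The localised normal vector `φ_T ∈ Hom_{T⁻¹R}(I·T⁻¹R, T⁻¹R/I·T⁻¹R)`** of `φ ∈ Hom_R(I, R/I)`: the `T⁻¹R`-linear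
map induced on the localisations `I → I·T⁻¹R` (Mathlib: `Algebra.idealMap_isLocalizedModule`) and
`R/I → T⁻¹R/I·T⁻¹R` (tree: `isLocalizedModule_quotientMapₗ`).  [cite: Hartshorne2010, §2 Thm. 2.4] -/
noncomputable def locNormal (φ : I →ₗ[R] R ⧸ I) :
    I.map (algebraMap R S) →ₗ[S] S ⧸ I.map (algebraMap R S) :=
  haveI := isLocalizedModule_quotientMapₗ T S I
  (IsLocalizedModule.map T (Algebra.idealMap S I) (quotientMapₗ S I) φ).extendScalarsOfIsLocalization T S

/-- `φ_T (x/1) = φ(x)/1`: the defining square commutes. [folklore] -/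
theorem locNormal_apply_algebraMap (φ : I →ₗ[R] R ⧸ I) (x : I) :
    locNormal T S I φ ⟨algebraMap R S x, Ideal.mem_map_of_mem _ x.2⟩ = quotientMapₗ S I (φ x) := by
  haveI := isLocalizedModule_quotientMapₗ T S I
  have hx : (⟨algebraMap R S x, Ideal.mem_map_of_mem _ x.2⟩ : I.map (algebraMap R S)) = Algebra.idealMap S I x :=
    Subtype.ext rfl
  rw [locNormal, LinearMap.extendScalarsOfIsLocalization_apply', hx, IsLocalizedModule.map_apply]

/-- **`φ_T` is compatible with `φ`** along `R → T⁻¹R`. [folklore] -/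
theorem compatible_locNormal (φ : I →ₗ[R] R ⧸ I) : Compatible (algebraMap R S) φ (locNormal T S I φ) := by
  intro x y hy
  rw [locNormal_apply_algebraMap, ← hy, quotientMapₗ_mk]

/-- **Uniqueness**: any `T⁻¹R`-linear map on `I·T⁻¹R` compatible with `φ` is `φ_T`. [folklore] -/
theorem eq_locNormal_of_compatible {φ : I →ₗ[R] R ⧸ I}
    {ψ : I.map (algebraMap R S) →ₗ[S] S ⧸ I.map (algebraMap R S)} (hc : Compatible (algebraMap R S) φ ψ) :
    ψ = locNormal T S I φ :=
  hc.unique (compatible_locNormal T S I φ)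

include T in
/-- Existence and uniqueness in one statement. [cite: Hartshorne2010, §2 Thm. 2.4] -/
theorem existsUnique_compatible (φ : I →ₗ[R] R ⧸ I) :
    ∃! ψ : I.map (algebraMap R S) →ₗ[S] S ⧸ I.map (algebraMap R S), Compatible (algebraMap R S) φ ψ :=
  ⟨locNormal T S I φ, compatible_locNormal T S I φ, fun _ hψ ↦ eq_locNormal_of_compatible T S I hψ⟩

/-- `0_T = 0`. [folklore] -/
theorem locNormal_zero : locNormal T S I 0 = 0 :=
  (eq_locNormal_of_compatible T S I Compatible.zero).symm

/-- `(φ + φ')_T = φ_T + φ'_T`. [folklore] -/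
theorem locNormal_add (φ φ' : I →ₗ[R] R ⧸ I) :
    locNormal T S I (φ + φ') = locNormal T S I φ + locNormal T S I φ' :=
  (eq_locNormal_of_compatible T S I ((compatible_locNormal T S I φ).add (compatible_locNormal T S I φ'))).symm

/-- **Hartshorne Thm. 2.4, «the construction is compatible with localization»**: the restriction of Hartshorne's
`I'` with normal vector `φ` to the open `Spec T⁻¹R ⊂ Spec R` — its extension along `R[ε] → T⁻¹R[ε]` — is the `I'` of
the localised normal vector `φ_T`. [cite: Hartshorne2010, §2 Thm. 2.4] -/
theorem map_liftIdeal_eq_liftIdeal_locNormal (φ : I →ₗ[R] R ⧸ I) :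
    (liftIdeal I φ).map (mapRingHom (algebraMap R S)) = liftIdeal (I.map (algebraMap R S)) (locNormal T S I φ) :=
  map_mapRingHom_liftIdeal (compatible_locNormal T S I φ)

include T in
/-- The restriction of a flat embedded first-order deformation of `V(I) ⊂ Spec R` to `Spec T⁻¹R` is a flat
embedded first-order deformation of `V(I·T⁻¹R)`. [cite: Hartshorne2010, §2 Thm. 2.4] -/
theorem isEmbeddedDeformation_map_of_isLocalization {J : Ideal R[ε]} (hJ : IsEmbeddedDeformation I J) :
    IsEmbeddedDeformation (I.map (algebraMap R S)) (J.map (mapRingHom (algebraMap R S))) :=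
  isEmbeddedDeformation_map_mapRingHom hJ (compatible_locNormal T S I hJ.normalVector)

/-- … with normal vector the localisation of the normal vector: `φ_{J·T⁻¹R[ε]} = (φ_J)_T`.
[cite: Hartshorne2010, §2 Thm. 2.4] -/
theorem normalVector_map_of_isLocalization {J : Ideal R[ε]} (hJ : IsEmbeddedDeformation I J) :
    (isEmbeddedDeformation_map_of_isLocalization T S I hJ).normalVector = locNormal T S I hJ.normalVector :=
  normalVector_map_mapRingHom hJ (compatible_locNormal T S I hJ.normalVector)

/-- **Restriction of `D̄|_I` is `D̄_T|_{I_T}`**: for a derivation `D` of `R` and a derivation `D'` of `T⁻¹R` extending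
it (`D'(a/1) = (D a)/1`), `(D̄|_I)_T = D̄'|_{I·T⁻¹R}` — so the Čech components `π(θ_αβ)` of Prop. K restrict
consistently to smaller overlaps. [folklore] -/
theorem locNormal_derivToNormal {A : Type*} [CommRing A] [Algebra A R] {B : Type*} [CommRing B] [Algebra B S]
    (D : Derivation A R R) (D' : Derivation B S S) (hD : ∀ a, algebraMap R S (D a) = D' (algebraMap R S a)) :
    locNormal T S I (derivToNormal I D) = derivToNormal (I.map (algebraMap R S)) D' :=
  (eq_locNormal_of_compatible T S I (compatible_derivToNormal D D' hD)).symm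

/-- **Prop. K's local step on an overlap**: restricting the twisted lift `twist D (J_φ) = J_{φ + D̄|_I}` to
`Spec T⁻¹R` gives `J_{φ_T + D̄'|_{I_T}}`, the twist by the extended derivation of the restricted lift. [folklore] -/
theorem map_map_twist_liftIdeal_of_isLocalization {A : Type*} [CommRing A] [Algebra A R] {B : Type*} [CommRing B]
    [Algebra B S] (D : Derivation A R R) (D' : Derivation B S S)
    (hD : ∀ a, algebraMap R S (D a) = D' (algebraMap R S a)) (φ : I →ₗ[R] R ⧸ I) :
    ((liftIdeal I φ).map (twist D : R[ε] →+* R[ε])).map (mapRingHom (algebraMap R S)) =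
      liftIdeal (I.map (algebraMap R S)) (locNormal T S I φ + derivToNormal (I.map (algebraMap R S)) D') :=
  map_mapRingHom_map_twist_liftIdeal D D' hD (compatible_locNormal T S I φ)

end Localization

end EmbeddedDeformation

end Summit.Ventures.HSemireg
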